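import Literature.Analysis.FluidPDE.PressureHarmonicPart
import HarnessLib

/-!
# Tao's probe terms for BOUNDED velocities: the viscous, transport and potential terms are
# `O(R⁻²)`, `O(R⁻¹)`, `O(√R · R⁻¹)`

Analysis/FluidPDE support file (all results proved; no definitions, no named facts), companion of
`PressureNormalisationLq` (where the same three terms of the probe identity
`PressureNormalisation.fderiv_mollified_harmonicPart_eq` are bounded in `L^q × L^{q/2}`). Here
the velocity slice is merely **bounded**, `‖v‖ ≤ N` (bounded mild / Type-I-in-time ancient
solutions, Koch–Nadirashvili–Seregin–Šverák 2009 §4; Seregin 2014 §6.3), and the weak pressure is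
any function `Q` of controlled growth `|Q(x₀ − y) − Q(x₀)| ≤ B₀ + B₁ √(1+|y|)` (the Riesz pressure
modulo constants of `RieszPressureModConst`). With `Φ = χ_R ⋆ θ`, `R ≥ 1`, `θ` of outer radius
`≤ 1`:

* `exists_bound_laplacian_bounded`: `|∫ ⟪v, Δ(Φ(x₀ − ·)) a⟫| ≤ K N R⁻²`;
* `exists_bound_transport_bounded`: `|∫ ⟪v, (v·∇)(Φ(x₀ − ·)) a⟫| ≤ K N² R⁻¹`;
* `exists_bound_potential_bounded`: `|∫ ∂ₐΦ(y) Q(x₀ − y) dy| ≤ K (B₀ + B₁ √(2+2R)) R⁻¹`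
  (`∫ ∂ₐΦ = 0` removes the constant `Q(x₀)`).

All three are `|kernel| ≤ C (mR³)⁻¹ R^{-k}` on a ball of volume `≤ 27 |B̄₁| R³`
(`norm_integral_le_of_kernel_bound` of `PressureNormalisationL3`). The fourth (time-derivative)
term is NOT small for bounded data — it is handled by conservation of momentum in
`BoundedMildPressureIdentification`.

## References

* T. Tao, Anal. PDE 6 (2013) = arXiv:1108.1165, §4, proof of Lemma 4.1 (i). [Tao2011]
* G. Koch, N. Nadirashvili, G. Seregin, V. Šverák, Acta Math. 203 (2009) = arXiv:0709.3599,
  §4. [KochNadirashviliSereginSverak2009]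
-/

noncomputable section

open MeasureTheory Set Filter Metric Function ContinuousLinearMap
open scoped Topology Laplacian ContDiff Convolution InnerProductSpace RealInnerProductSpace ENNReal

namespace Literature.Analysis.FluidPDE

namespace PressureNormalisation

open PressureNormalisationL3

/-- The ball `B̄(x₀, 2R+1)` has volume `≤ 27 |B̄(0,1)| R³` for `R ≥ 1`. [folklore] -/
private theorem volume_real_closedBall_le' {R : ℝ} (hR : 1 ≤ R) (x₀ : EuclideanSpace ℝ (Fin 3)) :
    (volume : Measure (EuclideanSpace ℝ (Fin 3))).real (closedBall x₀ (2 * R + 1)) ≤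
      27 * (volume : Measure (EuclideanSpace ℝ (Fin 3))).real
        (closedBall (0 : EuclideanSpace ℝ (Fin 3)) 1) * R ^ 3 := by
  rw [Measure.addHaar_real_closedBall' volume x₀ (by linarith), finrank_euclideanSpace_fin]
  have h : (2 * R + 1) ^ 3 ≤ 27 * R ^ 3 := by
    nlinarith [pow_le_pow_left₀ (by linarith : (0:ℝ) ≤ 2 * R + 1) (by linarith : 2 * R + 1 ≤ 3 * R) 3]
  calc (2 * R + 1) ^ 3 * (volume : Measure (EuclideanSpace ℝ (Fin 3))).real (closedBall 0 1)
      ≤ 27 * R ^ 3 * (volume : Measure (EuclideanSpace ℝ (Fin 3))).real (closedBall 0 1) :=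
        mul_le_mul_of_nonneg_right h measureReal_nonneg
    _ = _ := by ring

/-- `∫_{B̄(x₀,2R+1)} 1 ≤ 27 |B̄₁| R³` (`R ≥ 1`). [folklore] -/
private theorem setIntegral_one_closedBall_le {R : ℝ} (hR : 1 ≤ R) (x₀ : EuclideanSpace ℝ (Fin 3)) :
    ∫ _y in closedBall x₀ (2 * R + 1), (1 : ℝ) ≤
      27 * (volume : Measure (EuclideanSpace ℝ (Fin 3))).real
        (closedBall (0 : EuclideanSpace ℝ (Fin 3)) 1) * R ^ 3 := by
  rw [setIntegral_const, smul_eq_mul, mul_one]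
  exact volume_real_closedBall_le' hR x₀

variable (φ : ContDiffBump (0 : EuclideanSpace ℝ (Fin 3)))

/-- **The viscous term for bounded data**: `|∫ ⟪v, Δ(Φ(x₀ − ·)) a⟫| ≤ K N R⁻²` whenever
`‖v‖ ≤ N`, `R ≥ 1` (`|ΔΦ| ≤ C₂(mR³)⁻¹R⁻²` on a ball of volume `≤ 27|B̄₁|R³`).
[cite: Tao2011, §4, proof of Lemma 4.1 (i)] -/
theorem exists_bound_laplacian_bounded (hφ : φ.rOut ≤ 1) (a : EuclideanSpace ℝ (Fin 3)) :
    ∃ K, 0 ≤ K ∧ ∀ (v : EuclideanSpace ℝ (Fin 3) → EuclideanSpace ℝ (Fin 3)) (N : ℝ),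
      Continuous v → (∀ y, ‖v y‖ ≤ N) → ∀ R : ℝ, 1 ≤ R → ∀ x₀ : EuclideanSpace ℝ (Fin 3),
      |∫ y, ⟪v y, (Δ (fun y => (probeBump R ⋆ φ.normed volume) (x₀ - y))) y • a⟫| ≤
        K * N * R⁻¹ ^ 2 := by
  obtain ⟨⟨C₁, hC₁⟩, ⟨C₂, hC₂⟩⟩ := exists_bound_baseBump_derivs (E := EuclideanSpace ℝ (Fin 3))
  have hC₂0 : 0 ≤ C₂ := (abs_nonneg _).trans (hC₂ 0)
  set m := baseBumpMass (EuclideanSpace ℝ (Fin 3)) with hm_def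
  have hm : 0 < m := baseBumpMass_pos
  set V₁ := (volume : Measure (EuclideanSpace ℝ (Fin 3))).real
    (closedBall (0 : EuclideanSpace ℝ (Fin 3)) 1) with hV₁
  have hV₁0 : 0 ≤ V₁ := measureReal_nonneg
  refine ⟨‖a‖ * m⁻¹ * C₂ * (27 * V₁), by positivity, ?_⟩
  intro v N hvc hvN R hR1 x₀
  have hR : 0 < R := one_pos.trans_le hR1
  have hN0 : 0 ≤ N := (norm_nonneg _).trans (hvN 0)
  set Φ := probeBump R ⋆ φ.normed volume with hΦ
  have hΦ2 : ContDiff ℝ 2 Φ := contDiff_probeConv φ hR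
  set L : EuclideanSpace ℝ (Fin 3) → ℝ := Δ (fun y => Φ (x₀ - y)) with hL
  have hL' : ∀ y, L y = (Δ Φ) (x₀ - y) := fun y => laplacian_comp_const_sub Φ x₀ y
  have hLc : Continuous L := by
    have : L = fun y => (Δ Φ) (x₀ - y) := funext hL'
    rw [this]
    exact (FluidPDE.continuous_laplacian hΦ2).comp (continuous_const.sub continuous_id)
  set κ : ℝ := ‖a‖ * ((m * R ^ 3)⁻¹ * R⁻¹ ^ 2 * C₂) * N with hκ
  have hκ0 : 0 ≤ κ := by positivity
  have hF : ∀ y, ‖⟪v y, L y • a⟫‖ ≤ κ * (1 : ℝ) := fun y => by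
    rw [Real.norm_eq_abs, inner_smul_right, abs_mul, hL' y, mul_one]
    calc |(Δ Φ) (x₀ - y)| * |⟪v y, a⟫| ≤ ((m * R ^ 3)⁻¹ * R⁻¹ ^ 2 * C₂) * (‖v y‖ * ‖a‖) :=
          mul_le_mul (abs_laplacian_probeConv_le φ hR hC₂ _) (abs_real_inner_le_norm _ _)
            (abs_nonneg _) (by positivity)
      _ ≤ ((m * R ^ 3)⁻¹ * R⁻¹ ^ 2 * C₂) * (N * ‖a‖) := by gcongr; exact hvN y
      _ = κ := by rw [hκ]; ring
  have hF0 : ∀ y, 2 * R + 1 < dist y x₀ → ⟪v y, L y • a⟫ = 0 := fun y hy => by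
    rw [hL' y, laplacian_probeConv_eq_zero φ hR, zero_smul, inner_zero_right]
    rw [← norm_neg, neg_sub, ← dist_eq_norm]
    linarith
  have hFm : AEStronglyMeasurable (fun y => ⟪v y, L y • a⟫) volume :=
    (hvc.inner (hLc.smul continuous_const)).aestronglyMeasurable
  obtain ⟨-, hI⟩ := norm_integral_le_of_kernel_bound (H := fun _ => (1 : ℝ))
    (integrableOn_const measure_closedBall_lt_top.ne) hFm hF hF0
  rw [← Real.norm_eq_abs]
  refine hI.trans ?_
  calc κ * ∫ y in closedBall x₀ (2 * R + 1), (1 : ℝ) ≤ κ * (27 * V₁ * R ^ 3) :=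
        mul_le_mul_of_nonneg_left (setIntegral_one_closedBall_le hR1 x₀) hκ0
    _ = ‖a‖ * m⁻¹ * C₂ * (27 * V₁) * N * R⁻¹ ^ 2 := by rw [hκ]; field_simp

/-- **The transport term for bounded data**: `|∫ ⟪v, (v·∇)(Φ(x₀ − ·)) a⟫| ≤ K N² R⁻¹`
whenever `‖v‖ ≤ N`, `R ≥ 1` (`‖DΦ‖ ≤ C₁(mR³)⁻¹R⁻¹`). [cite: Tao2011, §4, proof of Lemma 4.1 (i)] -/
theorem exists_bound_transport_bounded (hφ : φ.rOut ≤ 1) (a : EuclideanSpace ℝ (Fin 3)) :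
    ∃ K, 0 ≤ K ∧ ∀ (v : EuclideanSpace ℝ (Fin 3) → EuclideanSpace ℝ (Fin 3)) (N : ℝ),
      Continuous v → (∀ y, ‖v y‖ ≤ N) → ∀ R : ℝ, 1 ≤ R → ∀ x₀ : EuclideanSpace ℝ (Fin 3),
      |∫ y, ⟪v y, fderiv ℝ (fun y => (probeBump R ⋆ φ.normed volume) (x₀ - y)) y (v y) • a⟫| ≤
        K * N ^ 2 * R⁻¹ := by
  obtain ⟨⟨C₁, hC₁⟩, ⟨C₂, hC₂⟩⟩ := exists_bound_baseBump_derivs (E := EuclideanSpace ℝ (Fin 3))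
  have hC₁0 : 0 ≤ C₁ := (norm_nonneg _).trans (hC₁ 0)
  set m := baseBumpMass (EuclideanSpace ℝ (Fin 3)) with hm_def
  have hm : 0 < m := baseBumpMass_pos
  set V₁ := (volume : Measure (EuclideanSpace ℝ (Fin 3))).real
    (closedBall (0 : EuclideanSpace ℝ (Fin 3)) 1) with hV₁
  have hV₁0 : 0 ≤ V₁ := measureReal_nonneg
  refine ⟨‖a‖ * m⁻¹ * C₁ * (27 * V₁), by positivity, ?_⟩
  intro v N hvc hvN R hR1 x₀
  have hR : 0 < R := one_pos.trans_le hR1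
  have hN0 : 0 ≤ N := (norm_nonneg _).trans (hvN 0)
  set Φ := probeBump R ⋆ φ.normed volume with hΦ
  have hΦ1 : ContDiff ℝ 1 Φ := contDiff_probeConv φ hR
  have hD : ∀ y, fderiv ℝ (fun y => Φ (x₀ - y)) y = -fderiv ℝ Φ (x₀ - y) := fun y =>
    fderiv_comp_const_sub Φ x₀ y
  set κ : ℝ := ‖a‖ * ((m * R ^ 3)⁻¹ * R⁻¹ * C₁) * N ^ 2 with hκ
  have hκ0 : 0 ≤ κ := by positivity
  have hF : ∀ y, ‖⟪v y, fderiv ℝ (fun y => Φ (x₀ - y)) y (v y) • a⟫‖ ≤ κ * (1 : ℝ) := fun y => by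
    rw [Real.norm_eq_abs, inner_smul_right, abs_mul, hD y, mul_one]
    calc |(-fderiv ℝ Φ (x₀ - y)) (v y)| * |⟪v y, a⟫|
        ≤ (‖fderiv ℝ Φ (x₀ - y)‖ * ‖v y‖) * (‖v y‖ * ‖a‖) := by
          refine mul_le_mul ?_ (abs_real_inner_le_norm _ _) (abs_nonneg _) (by positivity)
          rw [_root_.neg_apply, abs_neg, ← Real.norm_eq_abs]
          exact ContinuousLinearMap.le_opNorm _ _
      _ ≤ (((m * R ^ 3)⁻¹ * R⁻¹ * C₁) * N) * (N * ‖a‖) :=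
          mul_le_mul (mul_le_mul (norm_fderiv_probeConv_le φ hR hC₁ _) (hvN y) (norm_nonneg _)
            (by positivity)) (mul_le_mul_of_nonneg_right (hvN y) (norm_nonneg _))
            (by positivity) (by positivity)
      _ = κ := by rw [hκ]; ring
  have hF0 : ∀ y, 2 * R + 1 < dist y x₀ → ⟪v y, fderiv ℝ (fun y => Φ (x₀ - y)) y (v y) • a⟫ = 0 := by
    intro y hy
    have hy' : 2 * R + φ.rOut < ‖x₀ - y‖ := by
      rw [← norm_neg, neg_sub, ← dist_eq_norm]; linarith
    have hz : fderiv ℝ Φ (x₀ - y) = 0 := by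
      ext w
      rw [fderiv_probeConv_apply_eq_zero φ hR hy']
      rfl
    rw [hD y, hz, neg_zero, _root_.zero_apply, zero_smul, inner_zero_right]
  have hFm : AEStronglyMeasurable
      (fun y => ⟪v y, fderiv ℝ (fun y => Φ (x₀ - y)) y (v y) • a⟫) volume := by
    have hc : Continuous fun y => fderiv ℝ (fun y => Φ (x₀ - y)) y (v y) := by
      have e : (fun y => fderiv ℝ (fun y => Φ (x₀ - y)) y (v y)) =
          fun y => (-fderiv ℝ Φ (x₀ - y)) (v y) := funext fun y => by rw [hD y]
      rw [e]
      exact ((hΦ1.continuous_fderiv one_ne_zero).comp (continuous_const.sub continuous_id)).neg.clm_apply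
        hvc
    exact (hvc.inner (hc.smul continuous_const)).aestronglyMeasurable
  obtain ⟨-, hI⟩ := norm_integral_le_of_kernel_bound (H := fun _ => (1 : ℝ))
    (integrableOn_const measure_closedBall_lt_top.ne) hFm hF hF0
  rw [← Real.norm_eq_abs]
  refine hI.trans ?_
  calc κ * ∫ y in closedBall x₀ (2 * R + 1), (1 : ℝ) ≤ κ * (27 * V₁ * R ^ 3) :=
        mul_le_mul_of_nonneg_left (setIntegral_one_closedBall_le hR1 x₀) hκ0
    _ = ‖a‖ * m⁻¹ * C₁ * (27 * V₁) * N ^ 2 * R⁻¹ := by rw [hκ]; field_simp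

/-- **The potential term for a weak pressure of controlled growth**: if `Q` is continuous with
`|Q(x₀ − y) − Q(x₀)| ≤ B₀ + B₁ √(1 + |y|)` for all `y` (`B₁ ≥ 0`), then for `R ≥ 1`
`|∫ ∂ₐΦ(y) Q(x₀ − y) dy| ≤ K (B₀ + B₁ √(2 + 2R)) R⁻¹` (the constant `Q(x₀)` is removed by
`∫ ∂ₐΦ = 0`; `|∂ₐΦ| ≤ C₁ (mR³)⁻¹ R⁻¹ ‖a‖` on a ball of volume `≤ 27|B̄₁|R³`).
[cite: Tao2011, §4, proof of Lemma 4.1 (i)] -/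
theorem exists_bound_potential_bounded (hφ : φ.rOut ≤ 1) (a : EuclideanSpace ℝ (Fin 3)) :
    ∃ K, 0 ≤ K ∧ ∀ (Q : EuclideanSpace ℝ (Fin 3) → ℝ) (B₀ B₁ : ℝ) (x₀ : EuclideanSpace ℝ (Fin 3)),
      Continuous Q → 0 ≤ B₁ → (∀ y, |Q (x₀ - y) - Q x₀| ≤ B₀ + B₁ * Real.sqrt (1 + ‖y‖)) →
      ∀ R : ℝ, 1 ≤ R →
      |∫ y, fderiv ℝ (probeBump R ⋆ φ.normed volume) y a * Q (x₀ - y)| ≤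
        K * (B₀ + B₁ * Real.sqrt (2 + 2 * R)) * R⁻¹ := by
  obtain ⟨⟨C₁, hC₁⟩, ⟨C₂, hC₂⟩⟩ := exists_bound_baseBump_derivs (E := EuclideanSpace ℝ (Fin 3))
  have hC₁0 : 0 ≤ C₁ := (norm_nonneg _).trans (hC₁ 0)
  set m := baseBumpMass (EuclideanSpace ℝ (Fin 3)) with hm_def
  have hm : 0 < m := baseBumpMass_pos
  set V₁ := (volume : Measure (EuclideanSpace ℝ (Fin 3))).real
    (closedBall (0 : EuclideanSpace ℝ (Fin 3)) 1) with hV₁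
  have hV₁0 : 0 ≤ V₁ := measureReal_nonneg
  refine ⟨‖a‖ * m⁻¹ * C₁ * (27 * V₁), by positivity, ?_⟩
  intro Q B₀ B₁ x₀ hQc hB₁ hQ R hR1
  have hR : 0 < R := one_pos.trans_le hR1
  have hB₀ : 0 ≤ B₀ + B₁ * Real.sqrt (2 + 2 * R) := by
    have h0 := hQ 0
    rw [sub_zero, sub_self, abs_zero, norm_zero, add_zero, Real.sqrt_one, mul_one] at h0
    have : B₁ ≤ B₁ * Real.sqrt (2 + 2 * R) := by
      refine le_mul_of_one_le_right hB₁ ?_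
      rw [show (1 : ℝ) = Real.sqrt 1 by rw [Real.sqrt_one]]
      exact Real.sqrt_le_sqrt (by linarith)
    linarith
  set Φ := probeBump R ⋆ φ.normed volume with hΦ
  have hΦ1 : ContDiff ℝ 1 Φ := contDiff_probeConv φ hR
  have hΦc : HasCompactSupport Φ := hasCompactSupport_probeConv φ hR
  -- remove the constant `Q x₀`
  have hzero : ∫ y, fderiv ℝ Φ y a = 0 := FluidPDE.integral_fderiv_apply_eq_zero hΦ1 hΦc a
  have hDc : Continuous fun y => fderiv ℝ Φ y a :=
    (hΦ1.continuous_fderiv one_ne_zero).clm_apply continuous_const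
  have hDs : HasCompactSupport fun y => fderiv ℝ Φ y a := hΦc.fderiv_apply (𝕜 := ℝ) a
  have i1 : Integrable fun y => fderiv ℝ Φ y a * Q (x₀ - y) :=
    (hDc.mul (hQc.comp (continuous_const.sub continuous_id))).integrable_of_hasCompactSupport hDs.mul_right
  have i2 : Integrable fun y => fderiv ℝ Φ y a * Q x₀ :=
    (hDc.mul continuous_const).integrable_of_hasCompactSupport hDs.mul_right
  have e1 : ∫ y, fderiv ℝ Φ y a * Q (x₀ - y) = ∫ y, fderiv ℝ Φ y a * (Q (x₀ - y) - Q x₀) := by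
    have : ∫ y, fderiv ℝ Φ y a * (Q (x₀ - y) - Q x₀) =
        (∫ y, fderiv ℝ Φ y a * Q (x₀ - y)) - ∫ y, fderiv ℝ Φ y a * Q x₀ := by
      rw [← integral_sub i1 i2]
      exact integral_congr_ae (Eventually.of_forall fun y => by ring)
    rw [this, integral_mul_const, hzero, zero_mul, sub_zero]
  rw [e1]
  -- kernel bound on the ball `B̄(0, 2R+1)`
  set κ : ℝ := ((m * R ^ 3)⁻¹ * R⁻¹ * C₁ * ‖a‖) * (B₀ + B₁ * Real.sqrt (2 + 2 * R)) with hκ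
  have hκ0 : 0 ≤ κ := by positivity
  have hF : ∀ y, ‖fderiv ℝ Φ y a * (Q (x₀ - y) - Q x₀)‖ ≤ κ * (1 : ℝ) := fun y => by
    rw [mul_one, norm_mul, Real.norm_eq_abs, Real.norm_eq_abs]
    by_cases hy : ‖y‖ ≤ 2 * R + 1
    · have h1 : |fderiv ℝ Φ y a| ≤ (m * R ^ 3)⁻¹ * R⁻¹ * C₁ * ‖a‖ :=
        abs_fderiv_probeConv_apply_le φ hR hC₁ y a
      have hs : Real.sqrt (1 + ‖y‖) ≤ Real.sqrt (2 + 2 * R) := Real.sqrt_le_sqrt (by linarith)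
      have h2 : |Q (x₀ - y) - Q x₀| ≤ B₀ + B₁ * Real.sqrt (2 + 2 * R) := by
        linarith [mul_le_mul_of_nonneg_left hs hB₁, hQ y]
      exact mul_le_mul h1 h2 (abs_nonneg _) (by positivity)
    · rw [not_le] at hy
      have hy' : 2 * R + φ.rOut < ‖y‖ := by linarith
      rw [fderiv_probeConv_apply_eq_zero φ hR hy', abs_zero, zero_mul]
      exact hκ0
  have hF0 : ∀ y, 2 * R + 1 < dist y (0 : EuclideanSpace ℝ (Fin 3)) →
      fderiv ℝ Φ y a * (Q (x₀ - y) - Q x₀) = 0 := fun y hy => by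
    rw [dist_zero_right] at hy
    have hy' : 2 * R + φ.rOut < ‖y‖ := by linarith
    rw [fderiv_probeConv_apply_eq_zero φ hR hy', zero_mul]
  have hFm : AEStronglyMeasurable (fun y => fderiv ℝ Φ y a * (Q (x₀ - y) - Q x₀)) volume :=
    (hDc.mul ((hQc.comp (continuous_const.sub continuous_id)).sub continuous_const)).aestronglyMeasurable
  obtain ⟨-, hI⟩ := norm_integral_le_of_kernel_bound (H := fun _ => (1 : ℝ))
    (x₀ := (0 : EuclideanSpace ℝ (Fin 3)))
    (integrableOn_const measure_closedBall_lt_top.ne) hFm hF hF0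
  rw [← Real.norm_eq_abs]
  refine hI.trans ?_
  calc κ * ∫ y in closedBall (0 : EuclideanSpace ℝ (Fin 3)) (2 * R + 1), (1 : ℝ)
      ≤ κ * (27 * V₁ * R ^ 3) := mul_le_mul_of_nonneg_left (setIntegral_one_closedBall_le hR1 0) hκ0
    _ = ‖a‖ * m⁻¹ * C₁ * (27 * V₁) * (B₀ + B₁ * Real.sqrt (2 + 2 * R)) * R⁻¹ := by
        rw [hκ]; field_simp

end PressureNormalisation

end Literature.Analysis.FluidPDE

end
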